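import Literature.Computability.Complexity.TVHardnessTseitin
import HarnessLib

/-!
# The prefix code of a formula as a token list: span lengths, and the pre-order Tseitin clauses
# read off positions (three clauses a node)

Literature / complexity — second file of the `PSPACE`-hardness of Trevisan–Vadhan's `LTV`: the
combinatorics that lets a polynomial-time scan of the prefix code `PropForm.code φ` (`CNF.lean`:
`var n ↦ 00⟨bin n, ε⟩`, `const b ↦ 01b`, `¬ ↦ 10`, `∧ ↦ 110`, `∨ ↦ 111`) emit the pre-order Tseitin
clauses of `TVHardnessTseitin.lean` WITHOUT a parse tree:

* `PreTseitin.Tok`, `toks φ` (the nodes in pre-order), `tokCode`, **`code_eq_flatten_toks`**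
  (`code φ` is the concatenation of the token codes), `length_toks` (`= size`);
* `PreTseitin.spanLen` — the length of the shortest prefix of a token list that is a complete formula,
  by the classical counter ("open places": start `1`, a token of arity `r` adds `r − 1`);
  **`spanLen_toks_append`**: `spanLen (toks φ ++ rest) = size φ`;
* `PreTseitin.gcl3` — the gate clauses with every node contributing EXACTLY three clauses (short
  blocks repeat a clause; `eval_gcl3`: same truth value as `gcl`), `cnfP3`, `isTrue_iff_holdsFrom_pre3`
  (the instance statement for the padded clauses, `|cnfP3| = 3 size + 1 ≤ sizeOf`);
* `PreTseitin.blockAt L a t` — the three clauses of the node at position `t` of the token list `L`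
  computed from the token, `a + t`, `a + t + 1` and `a + t + 1 + spanLen (L ⇂ (t+1))` alone, and
  **`gcl3_eq_flatMap_blockAt`**: `gcl3 φ (a + t)` is the concatenation of the blocks at the positions
  `t, …, t + size − 1` of any token list in which `toks φ` starts at `t`.

Everything is proved; no named fact is introduced (D-0026).

## References

* S. Arora, B. Barak, CUP 2009, §0.1 (prefix codes), Lemma 6.11 (proof) [AroraBarakCC2009].
* L. Trevisan, S. Vadhan, Comput. Complexity 16 (2007), §4, Lemma 4.1 (ii) [TrevisanVadhan2007].
-/

namespace Literature.Computability.Complexity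

namespace PreTseitin

open _root_.Computability Literature.Barriers.QuantumAdvantage Literature.Barriers.QuantumAdvantage.TQBFRed Tseitin QBFUniv

/-! ### Tokens -/

/-- The node labels of a formula. [folklore] -/
inductive Tok
  | var (n : ℕ)
  | const (b : Bool)
  | neg
  | conj
  | disj
  deriving DecidableEq

/-- The nodes of a formula in pre-order. [cite: AroraBarakCC2009, §0.1] -/
def toks : PropForm ℕ → List Tok
  | .var n => [.var n]
  | .const b => [.const b]
  | .neg φ => .neg :: toks φ
  | .conj φ ψ => .conj :: (toks φ ++ toks ψ)
  | .disj φ ψ => .disj :: (toks φ ++ toks ψ)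

/-- The code of one token (`PropForm.code` restricted to the node). [cite: AroraBarakCC2009, §0.1] -/
def tokCode : Tok → List Bool
  | .var n => false :: false :: boolPair (encodeNat n) []
  | .const b => [false, true, b]
  | .neg => [true, false]
  | .conj => [true, true, false]
  | .disj => [true, true, true]

/-- The number of tokens is the size. [folklore] -/
theorem length_toks (φ : PropForm ℕ) : (toks φ).length = φ.size := by
  induction φ with
  | var n => rfl
  | const b => rfl
  | neg φ ih => simp [toks, PropForm.size, ih]
  | conj φ ψ ih₁ ih₂ => simp [toks, PropForm.size, ih₁, ih₂]
  | disj φ ψ ih₁ ih₂ => simp [toks, PropForm.size, ih₁, ih₂]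

/-- **The prefix code is the concatenation of the token codes.** [cite: AroraBarakCC2009, §0.1] -/
theorem code_eq_flatten_toks (φ : PropForm ℕ) : PropForm.code φ = ((toks φ).map tokCode).flatten := by
  induction φ with
  | var n => simp [toks, tokCode, PropForm.code]
  | const b => simp [toks, tokCode, PropForm.code]
  | neg φ ih => simp [toks, tokCode, PropForm.code, ih]
  | conj φ ψ ih₁ ih₂ => simp [toks, tokCode, PropForm.code, ih₁, ih₂]
  | disj φ ψ ih₁ ih₂ => simp [toks, tokCode, PropForm.code, ih₁, ih₂]

/-- The arity of a token. [folklore] -/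
def Tok.arity : Tok → ℕ
  | .var _ => 0
  | .const _ => 0
  | .neg => 1
  | .conj => 2
  | .disj => 2

/-! ### Span lengths -/

/-- Scanning with `need` open places: the number of tokens consumed until no place is open (or the
list ends). [cite: AroraBarakCC2009, §0.1] -/
def spanAux : List Tok → ℕ → ℕ
  | [], _ => 0
  | _, 0 => 0
  | tk :: L, need + 1 => spanAux L (need + tk.arity) + 1

/-- **The span length**: the length of the shortest prefix that is a complete formula. [cite: AroraBarakCC2009, §0.1] -/
def spanLen (L : List Tok) : ℕ := spanAux L 1

/-- With no open place nothing is consumed. [folklore] -/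
@[simp] theorem spanAux_zero (L : List Tok) : spanAux L 0 = 0 := by cases L <;> rfl

/-- Consuming a complete formula closes exactly one place. [folklore] -/
theorem spanAux_toks_append (φ : PropForm ℕ) : ∀ (rest : List Tok) (need : ℕ),
    spanAux (toks φ ++ rest) (need + 1) = φ.size + spanAux rest need := by
  induction φ with
  | var n => intro rest need; simp [toks, spanAux, Tok.arity, PropForm.size, Nat.add_comm]
  | const b => intro rest need; simp [toks, spanAux, Tok.arity, PropForm.size, Nat.add_comm]
  | neg φ ih =>
    intro rest need
    rw [toks, List.cons_append, spanAux, Tok.arity, ih rest need, PropForm.size]; omega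
  | conj φ ψ ih₁ ih₂ =>
    intro rest need
    rw [toks, List.cons_append, List.append_assoc, spanAux, Tok.arity, show need + 2 = need + 1 + 1 by rfl, ih₁, ih₂, PropForm.size]
    omega
  | disj φ ψ ih₁ ih₂ =>
    intro rest need
    rw [toks, List.cons_append, List.append_assoc, spanAux, Tok.arity, show need + 2 = need + 1 + 1 by rfl, ih₁, ih₂, PropForm.size]
    omega

/-- **The span of a formula followed by anything is its size.** [cite: AroraBarakCC2009, §0.1] -/
theorem spanLen_toks_append (φ : PropForm ℕ) (rest : List Tok) : spanLen (toks φ ++ rest) = φ.size := by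
  rw [spanLen, show (1 : ℕ) = 0 + 1 from rfl, spanAux_toks_append, spanAux_zero, Nat.add_zero]

/-- Span lengths never exceed the list. [folklore] -/
theorem spanAux_le (L : List Tok) : ∀ need, spanAux L need ≤ L.length := by
  induction L with
  | nil => intro need; simp [spanAux]
  | cons tk L ih => intro need; cases need with
    | zero => simp
    | succ need => rw [spanAux, List.length_cons]; exact Nat.succ_le_succ (ih _)

/-! ### Three clauses a node -/

/-- **The gate clauses, three a node** (short blocks repeat a clause; duplicates are harmless).
[cite: AroraBarakCC2009, Lemma 6.11 (proof)] -/
def gcl3 : PropForm ℕ → ℕ → CNF ℕ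
  | .var x, p => [[(p, false), (x, true)], [(p, true), (x, false)], [(p, true), (x, false)]]
  | .const b, p => [[(p, b)], [(p, b)], [(p, b)]]
  | .neg φ, p => [[(p, false), (p + 1, false)], [(p, true), (p + 1, true)], [(p, true), (p + 1, true)]] ++ gcl3 φ (p + 1)
  | .conj φ ψ, p => [[(p, false), (p + 1, true)], [(p, false), (p + 1 + φ.size, true)],
      [(p, true), (p + 1, false), (p + 1 + φ.size, false)]] ++ gcl3 φ (p + 1) ++ gcl3 ψ (p + 1 + φ.size)
  | .disj φ ψ, p => [[(p, false), (p + 1, true), (p + 1 + φ.size, true)], [(p, true), (p + 1, false)],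
      [(p, true), (p + 1 + φ.size, false)]] ++ gcl3 φ (p + 1) ++ gcl3 ψ (p + 1 + φ.size)

/-- Exactly `3 · size` clauses. [folklore] -/
theorem length_gcl3 (φ : PropForm ℕ) : ∀ p : ℕ, (gcl3 φ p).length = 3 * φ.size := by
  induction φ with
  | var x => intro p; rfl
  | const b => intro p; rfl
  | neg φ ih => intro p; simp only [gcl3, List.length_append, ih, PropForm.size]; simp; ring
  | conj φ ψ ih₁ ih₂ => intro p; simp only [gcl3, List.length_append, ih₁, ih₂, PropForm.size]; simp; ring
  | disj φ ψ ih₁ ih₂ => intro p; simp only [gcl3, List.length_append, ih₁, ih₂, PropForm.size]; simp; ring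

/-- The padded clauses are clauses of `gcl` (same set). [folklore] -/
theorem mem_gcl_of_mem_gcl3 (φ : PropForm ℕ) : ∀ (p : ℕ), ∀ c ∈ gcl3 φ p, c ∈ gcl φ p := by
  induction φ with
  | var x => intro p c hc; simp only [gcl3, List.mem_cons, List.not_mem_nil, or_false] at hc; simp only [gcl, List.mem_cons, List.not_mem_nil, or_false]; tauto
  | const b => intro p c hc; simp only [gcl3, List.mem_cons, List.not_mem_nil, or_false] at hc; simp only [gcl, List.mem_cons, List.not_mem_nil, or_false]; tauto
  | neg φ ih =>
    intro p c hc
    simp only [gcl3, List.cons_append, List.nil_append, List.mem_cons] at hc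
    simp only [gcl, List.cons_append, List.nil_append, List.mem_cons]
    rcases hc with h | h | h | h
    · exact Or.inl h
    · exact Or.inr (Or.inl h)
    · exact Or.inr (Or.inl h)
    · exact Or.inr (Or.inr (ih _ c h))
  | conj φ ψ ih₁ ih₂ =>
    intro p c hc
    simp only [gcl3, List.cons_append, List.nil_append, List.mem_cons, List.mem_append] at hc
    simp only [gcl, List.cons_append, List.nil_append, List.mem_cons, List.mem_append]
    rcases hc with h | h | h | h | h
    · exact Or.inl h
    · exact Or.inr (Or.inl h)
    · exact Or.inr (Or.inr (Or.inl h))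
    · exact Or.inr (Or.inr (Or.inr (Or.inl (ih₁ _ c h))))
    · exact Or.inr (Or.inr (Or.inr (Or.inr (ih₂ _ c h))))
  | disj φ ψ ih₁ ih₂ =>
    intro p c hc
    simp only [gcl3, List.cons_append, List.nil_append, List.mem_cons, List.mem_append] at hc
    simp only [gcl, List.cons_append, List.nil_append, List.mem_cons, List.mem_append]
    rcases hc with h | h | h | h | h
    · exact Or.inl h
    · exact Or.inr (Or.inl h)
    · exact Or.inr (Or.inr (Or.inl h))
    · exact Or.inr (Or.inr (Or.inr (Or.inl (ih₁ _ c h))))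
    · exact Or.inr (Or.inr (Or.inr (Or.inr (ih₂ _ c h))))

/-- The clauses of `gcl` are padded clauses. [folklore] -/
theorem mem_gcl3_of_mem_gcl (φ : PropForm ℕ) : ∀ (p : ℕ), ∀ c ∈ gcl φ p, c ∈ gcl3 φ p := by
  induction φ with
  | var x => intro p c hc; simp only [gcl, List.mem_cons, List.not_mem_nil, or_false] at hc; simp only [gcl3, List.mem_cons, List.not_mem_nil, or_false]; tauto
  | const b => intro p c hc; simp only [gcl, List.mem_cons, List.not_mem_nil, or_false] at hc; simp only [gcl3, List.mem_cons, List.not_mem_nil, or_false]; tauto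
  | neg φ ih =>
    intro p c hc
    simp only [gcl, List.cons_append, List.nil_append, List.mem_cons] at hc
    simp only [gcl3, List.cons_append, List.nil_append, List.mem_cons]
    rcases hc with h | h | h
    · exact Or.inl h
    · exact Or.inr (Or.inl h)
    · exact Or.inr (Or.inr (Or.inr (ih _ c h)))
  | conj φ ψ ih₁ ih₂ =>
    intro p c hc
    simp only [gcl, List.cons_append, List.nil_append, List.mem_cons, List.mem_append] at hc
    simp only [gcl3, List.cons_append, List.nil_append, List.mem_cons, List.mem_append]
    rcases hc with h | h | h | h | h
    · exact Or.inl h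
    · exact Or.inr (Or.inl h)
    · exact Or.inr (Or.inr (Or.inl h))
    · exact Or.inr (Or.inr (Or.inr (Or.inl (ih₁ _ c h))))
    · exact Or.inr (Or.inr (Or.inr (Or.inr (ih₂ _ c h))))
  | disj φ ψ ih₁ ih₂ =>
    intro p c hc
    simp only [gcl, List.cons_append, List.nil_append, List.mem_cons, List.mem_append] at hc
    simp only [gcl3, List.cons_append, List.nil_append, List.mem_cons, List.mem_append]
    rcases hc with h | h | h | h | h
    · exact Or.inl h
    · exact Or.inr (Or.inl h)
    · exact Or.inr (Or.inr (Or.inl h))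
    · exact Or.inr (Or.inr (Or.inr (Or.inl (ih₁ _ c h))))
    · exact Or.inr (Or.inr (Or.inr (Or.inr (ih₂ _ c h))))

/-- CNF truth only depends on the clause set. [folklore] -/
theorem cnf_eval_eq_true_iff (C : CNF ℕ) (τ : ℕ → Bool) : C.eval τ = true ↔ ∀ c ∈ C, Clause.eval τ c = true := by
  rw [CNF.eval, List.all_eq_true]; rfl

/-- **The padded clauses have the truth value of the gate clauses.** [folklore] -/
theorem eval_gcl3 (φ : PropForm ℕ) (p : ℕ) (τ : ℕ → Bool) : (gcl3 φ p).eval τ = (gcl φ p).eval τ := by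
  rw [Bool.eq_iff_iff, cnf_eval_eq_true_iff, cnf_eval_eq_true_iff]
  exact ⟨fun h c hc => h c (mem_gcl3_of_mem_gcl φ p c hc), fun h c hc => h c (mem_gcl_of_mem_gcl3 φ p c hc)⟩

/-- **The padded pre-order Tseitin CNF.** [cite: AroraBarakCC2009, Lemma 6.11 (proof)] -/
def cnfP3 (φ : PropForm ℕ) (a : ℕ) : CNF ℕ := gcl3 φ a ++ [[(a, true)]]

/-- Same truth value as `cnfP`. [folklore] -/
theorem eval_cnfP3 (φ : PropForm ℕ) (a : ℕ) (τ : ℕ → Bool) : (cnfP3 φ a).eval τ = (cnfP φ a).eval τ := by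
  have h1 : (cnfP3 φ a).eval τ = ((gcl3 φ a).eval τ && CNF.eval [[(a, true)]] τ) := by
    rw [cnfP3, CNF.eval, List.all_append]; rfl
  have h2 : (cnfP φ a).eval τ = ((gcl φ a).eval τ && CNF.eval [[(a, true)]] τ) := by
    rw [cnfP, CNF.eval, List.all_append]; rfl
  rw [h1, h2, eval_gcl3]

/-- Its length. [folklore] -/
theorem length_cnfP3 (φ : PropForm ℕ) (a : ℕ) : (cnfP3 φ a).length = 3 * φ.size + 1 := by
  rw [cnfP3, List.length_append, length_gcl3, List.length_singleton]

/-- Its variables (closed formula). [folklore] -/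
theorem cnfP3_vars_lt {ψ : PrenexQBF} (h : ψ.IsClosed) :
    ∀ c ∈ cnfP3 ψ.matrix ψ.quants.length, ∀ l ∈ c, l.1 < ψ.quants.length + ψ.matrix.size := by
  intro c hc l hl
  rw [cnfP3, List.mem_append] at hc
  rcases hc with hc | hc
  · exact cnfP_vars_lt h c (by rw [cnfP, List.mem_append]; exact Or.inl (mem_gcl_of_mem_gcl3 _ _ c hc)) l hl
  · exact cnfP_vars_lt h c (by rw [cnfP, List.mem_append]; exact Or.inr hc) l hl

/-- **The padded pre-order Tseitin form** of a prenex QBF. [cite: TrevisanVadhan2007, §4 (proof of Lemma 4.1)] -/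
def preQBF3 (ψ : PrenexQBF) : PrenexQBF :=
  ⟨ψ.quants ++ List.replicate ψ.matrix.size false, PropForm.ofCNF (cnfP3 ψ.matrix ψ.quants.length)⟩

/-- Same truth value as `preQBF`. [folklore] -/
theorem isTrue_preQBF3_iff (ψ : PrenexQBF) : (preQBF3 ψ).IsTrue ↔ (preQBF ψ).IsTrue := by
  rw [PrenexQBF.IsTrue, PrenexQBF.IsTrue, preQBF3, preQBF]
  simp only
  have h := qbfEval_congr_matrix (PropForm.ofCNF (cnfP3 ψ.matrix ψ.quants.length)) (PropForm.ofCNF (cnfP ψ.matrix ψ.quants.length)) []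
    (ψ.quants ++ List.replicate ψ.matrix.size false).length (fun σ => by simp [qbfEval, PropForm.eval_ofCNF, eval_cnfP3])
    (ψ.quants ++ List.replicate ψ.matrix.size false) 0 (fun _ => false) (by simp)
  rwa [List.append_nil] at h

/-- **Every closed prenex QBF is an instance of the universal formula through its PADDED pre-order
Tseitin form.** [cite: TrevisanVadhan2007, Lemma 4.1 (ii)] -/
theorem isTrue_iff_holdsFrom_pre3 {ψ : PrenexQBF} (h : ψ.IsClosed) :
    ψ.IsTrue ↔ HoldsFrom (instOf (QBFUniv.sizeOf ψ) (preQBF3 ψ).quants (cnfP3 ψ.matrix ψ.quants.length)) 0 := by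
  rw [← isTrue_preQBF_iff h, ← isTrue_preQBF3_iff]
  have hs := PropForm.size_pos ψ.matrix
  refine isTrue_iff_holdsFrom_instOf (by rw [QBFUniv.sizeOf]; omega) (by simp [QBFUniv.sizeOf]) ?_ ?_
  · rw [length_cnfP3, QBFUniv.sizeOf]; omega
  · intro c hc l hl
    simp only [List.length_append, List.length_replicate]
    exact cnfP3_vars_lt h c hc l hl

/-! ### The clauses of a node read off its position -/

/-- **The three clauses of the node at position `t`** of the token list `L`, auxiliaries from `a`:
computed from the token, `g = a + t`, `c₁ = g + 1` and `c₂ = c₁ + spanLen (L ⇂ (t+1))`.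
[cite: AroraBarakCC2009, Lemma 6.11 (proof)] -/
def blockAt (L : List Tok) (a t : ℕ) : CNF ℕ :=
  let g := a + t
  let c₁ := g + 1
  let c₂ := c₁ + spanLen (L.drop (t + 1))
  match L.getD t (.const false) with
  | .var x => [[(g, false), (x, true)], [(g, true), (x, false)], [(g, true), (x, false)]]
  | .const b => [[(g, b)], [(g, b)], [(g, b)]]
  | .neg => [[(g, false), (c₁, false)], [(g, true), (c₁, true)], [(g, true), (c₁, true)]]
  | .conj => [[(g, false), (c₁, true)], [(g, false), (c₂, true)], [(g, true), (c₁, false), (c₂, false)]]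
  | .disj => [[(g, false), (c₁, true), (c₂, true)], [(g, true), (c₁, false)], [(g, true), (c₂, false)]]

/-- Concatenation of the blocks at the positions `t, …, t + m − 1`. [folklore] -/
def blocks (L : List Tok) (a t m : ℕ) : CNF ℕ := ((List.range m).map fun i => blockAt L a (t + i)).flatten

/-- Splitting a range of blocks. [folklore] -/
theorem blocks_add (L : List Tok) (a t m m' : ℕ) : blocks L a t (m + m') = blocks L a t m ++ blocks L a (t + m) m' := by
  simp only [blocks, List.range_add, List.map_append, List.flatten_append, List.map_map]
  congr 2
  apply List.map_congr_left
  intro i _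
  simp [Nat.add_assoc]

/-- One block. [folklore] -/
theorem blocks_one (L : List Tok) (a t : ℕ) : blocks L a t 1 = blockAt L a t := by simp [blocks]

/-- **The padded pre-order clauses are the blocks at the positions of the formula's tokens**: if
`toks φ` starts at position `t` of `L` then `gcl3 φ (a + t) = blocks L a t (size φ)`.
[cite: AroraBarakCC2009, Lemma 6.11 (proof), §0.1] -/
theorem gcl3_eq_blocks (φ : PropForm ℕ) : ∀ (L : List Tok) (a t : ℕ) (rest : List Tok), L.drop t = toks φ ++ rest →
    gcl3 φ (a + t) = blocks L a t φ.size := by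
  induction φ with
  | var x =>
    intro L a t rest hL
    have hget : L.getD t (.const false) = .var x := by
      rw [List.getD_eq_getElem?_getD, ← List.head?_drop, hL]; rfl
    rw [PropForm.size, blocks_one, blockAt, hget, gcl3]
  | const b =>
    intro L a t rest hL
    have hget : L.getD t (.const false) = .const b := by
      rw [List.getD_eq_getElem?_getD, ← List.head?_drop, hL]; rfl
    rw [PropForm.size, blocks_one, blockAt, hget, gcl3]
  | neg φ ih =>
    intro L a t rest hL
    have hget : L.getD t (.const false) = .neg := by
      rw [List.getD_eq_getElem?_getD, ← List.head?_drop, hL]; rfl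
    have hL' : L.drop (t + 1) = toks φ ++ rest := by
      rw [← List.drop_drop, hL]; rfl
    rw [PropForm.size, Nat.add_comm φ.size 1, blocks_add, blocks_one, blockAt, hget, gcl3, show a + t + 1 = a + (t + 1) by ring,
      ih L a (t + 1) rest hL']
  | conj φ ψ ih₁ ih₂ =>
    intro L a t rest hL
    have hget : L.getD t (.const false) = .conj := by
      rw [List.getD_eq_getElem?_getD, ← List.head?_drop, hL]; rfl
    have hL₁ : L.drop (t + 1) = toks φ ++ (toks ψ ++ rest) := by
      rw [← List.drop_drop, hL]; simp [toks]
    have hL₂ : L.drop (t + 1 + φ.size) = toks ψ ++ rest := by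
      rw [← List.drop_drop, hL₁, ← length_toks φ, List.drop_left]
    have hspan : spanLen (L.drop (t + 1)) = φ.size := by rw [hL₁, spanLen_toks_append]
    rw [PropForm.size, show φ.size + ψ.size + 1 = 1 + (φ.size + ψ.size) by ring, blocks_add, blocks_add, blocks_one, blockAt, hget, gcl3]
    simp only [hspan]
    rw [show a + t + 1 = a + (t + 1) by ring, ih₁ L a (t + 1) _ hL₁, show a + (t + 1) + φ.size = a + (t + 1 + φ.size) by ring,
      ih₂ L a (t + 1 + φ.size) rest hL₂, List.append_assoc]
  | disj φ ψ ih₁ ih₂ =>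
    intro L a t rest hL
    have hget : L.getD t (.const false) = .disj := by
      rw [List.getD_eq_getElem?_getD, ← List.head?_drop, hL]; rfl
    have hL₁ : L.drop (t + 1) = toks φ ++ (toks ψ ++ rest) := by
      rw [← List.drop_drop, hL]; simp [toks]
    have hL₂ : L.drop (t + 1 + φ.size) = toks ψ ++ rest := by
      rw [← List.drop_drop, hL₁, ← length_toks φ, List.drop_left]
    have hspan : spanLen (L.drop (t + 1)) = φ.size := by rw [hL₁, spanLen_toks_append]
    rw [PropForm.size, show φ.size + ψ.size + 1 = 1 + (φ.size + ψ.size) by ring, blocks_add, blocks_add, blocks_one, blockAt, hget, gcl3]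
    simp only [hspan]
    rw [show a + t + 1 = a + (t + 1) by ring, ih₁ L a (t + 1) _ hL₁, show a + (t + 1) + φ.size = a + (t + 1 + φ.size) by ring,
      ih₂ L a (t + 1 + φ.size) rest hL₂, List.append_assoc]

/-- **The padded pre-order Tseitin clauses of `φ` from `a` are the blocks of its own token list.**
[cite: AroraBarakCC2009, Lemma 6.11 (proof), §0.1] -/
theorem gcl3_eq_blocks_toks (φ : PropForm ℕ) (a : ℕ) : gcl3 φ a = blocks (toks φ) a 0 φ.size := by
  have := gcl3_eq_blocks φ (toks φ) a 0 [] (by simp)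
  simpa using this

/-- Clause `j < 3 size` of the padded CNF is clause `j % 3` of the block at position `j / 3`.
[folklore] -/
theorem getElem_blocks (L : List Tok) (a m : ℕ) {j : ℕ} (hj : j < (blocks L a 0 m).length) (hjm : j < 3 * m)
    (hlen : ∀ t, (blockAt L a t).length = 3) :
    (blocks L a 0 m)[j] = (blockAt L a (j / 3))[j % 3]'(by rw [hlen]; exact Nat.mod_lt _ (by norm_num)) := by
  induction m generalizing j with
  | zero => simp at hjm
  | succ m ih =>
    have hsplit : blocks L a 0 (m + 1) = blocks L a 0 m ++ blockAt L a m := by rw [blocks_add, blocks_one, Nat.zero_add]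
    have hlm : (blocks L a 0 m).length = 3 * m := by
      clear hj hjm hsplit ih
      induction m with
      | zero => simp [blocks]
      | succ m ihm => rw [blocks_add, List.length_append, ihm, blocks_one, Nat.zero_add, hlen]; ring
    simp only [hsplit]
    by_cases hlt : j < 3 * m
    · rw [List.getElem_append_left (by rw [hlm]; exact hlt)]
      exact ih (by rw [hlm]; exact hlt) hlt
    · have hjd : j / 3 = m := by omega
      have hjr : j % 3 = j - 3 * m := by omega
      rw [List.getElem_append_right (by rw [hlm]; omega)]
      simp only [hlm, hjd, hjr]

/-- Every block has three clauses. [folklore] -/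
theorem length_blockAt (L : List Tok) (a t : ℕ) : (blockAt L a t).length = 3 := by
  rw [blockAt]
  split <;> rfl

end PreTseitin

end Literature.Computability.Complexity
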